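import Summits.AtomisticToContinuum.BoseEinsteinCondensation.Theorems.CorrectorClosure.Negative.InsertionResidueOneExcitationState
import Summits.AtomisticToContinuum.BoseEinsteinCondensation.Theorems.CorrectorClosure.Negative.InsertionResidueConstantTight
import Literature.MathematicalPhysics.QuantumManyBody.PeriodicBoseGasTagged

/-!
# Negative lemmas for crux `CorrectorClosure` (stmt-AtomisticToContinuum-12058), VII:
near-minimisers at one coupling never form a single ray

Supports stmt-AtomisticToContinuum-12058 (route `BECInsertionCorrector`), PICKED line
`llp-fidelity-arc` (`Cruxes/CorrectorClosure/PICKED.md`, 2026-08-16; skeleton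
`Cruxes/CorrectorClosure/Lines/llp-fidelity-arc.lean`).

That line encodes the metric speed of the coupled ground-state path derivative-free, through the
hypothesis structure `LocalSpeedBound v N L s λ`: for every nearby coupling `λ' ≠ λ` there is ONE
window `δ > 0` such that EVERY `δ`-near-minimiser at `λ` and EVERY `δ`-near-minimiser at `λ'` are
within Fubini–Study angle `∫_{[λ,λ']} s` of each other. The lemma below is the free-gas fact that
makes the fine print of this encoding load-bearing: already for `v = 0` (where the coupled family
`H_λ` is CONSTANT in `λ`, true metric speed `≡ 0`) and for every window `δ > 0` there are two
tagged periodic trial states of tagged energy `0` and `≤ δ` — hence `δ`-near-minimisers of every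
`H_λ` built from `v = 0` — whose rays are distinct (`|⟨Ψ, Ψ'⟩| < 1`):
the constant and the tilted constant `(1 + ε N_k 1)/‖·‖`, `|⟨Ψ,Ψ'⟩| = (1 + (N+1)ε²)^{-1/2}`.
Consequently a speed majorant `s` with `∫_{[λ,λ']} s = 0` for some `λ' ≠ λ` can never satisfy
`LocalSpeedBound`, whatever the true speed: in `DressedPathBound` / `ArcChord` the majorant must
have positive mass on every subinterval (e.g. a floor `s ≥ ε`, harmless for the budget `∫ s ≤ θ`),
and on the saturated segment `λ ≥ v_max/(1+v_max)` of a bounded potential's ceiling path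
(`u_λ = v`, motionless) `s` may NOT be set to `0`. (The derivation `¬ LocalSpeedBound 0 N L 0 λ`
over verbatim copies of the line's definitions is in `Cruxes/CorrectorClosure/Disproof.lean` §12.)
-/

noncomputable section

open MeasureTheory Filter Metric WithLp
open scoped ENNReal NNReal ComplexConjugate BigOperators

namespace Summit.AtomisticToContinuum.BoseEinsteinCondensation.Theorems.CorrectorClosure.Negative

open Literature.MathematicalPhysics.QuantumManyBody.BoseGas
open Summit.AtomisticToContinuum.BoseEinsteinCondensation.Theses.BECInsertionCorrector

variable {M : ℕ} {L : ℝ}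

/-! ### Exact free energy of the one-excitation state -/

/-- **Exact free energy** of `(a + b N_k 1)/‖·‖`: `⟨Ψ,-ΔΨ⟩ = M|b|²|k|²/(|a|² + M|b|²)`. [folklore] -/
theorem periodicEnergy_zero_affineState_eq (hL : 0 < L) (hM : 0 < M) {n : Fin 3 → ℤ} (hn : n ≠ 0)
    {a b : ℂ} (hab : a ≠ 0 ∨ b ≠ 0) :
    periodicEnergy 0 (affineState hL hM hn hab) =
      ENNReal.ofReal (M * ‖b‖ ^ 2 * momSq L n / (‖a‖ ^ 2 + M * ‖b‖ ^ 2)) := by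
  unfold affineState
  rw [periodicEnergy_zero_ofFun]
  simp_rw [kineticDensity_affine]
  rw [setLIntegral_const, volume_cellN, lintegral_cellN_nnnorm_sq_affine hL hn]
  have hV : ((ENNReal.ofReal L) ^ 3) ^ M = ENNReal.ofReal ((L ^ 3) ^ M) := by
    rw [← ENNReal.ofReal_pow hL.le, ← ENNReal.ofReal_pow (by positivity)]
  rw [hV]
  have hM' : (0 : ℝ) < M := by exact_mod_cast hM
  have hS : 0 < ‖a‖ ^ 2 + M * ‖b‖ ^ 2 := by
    rcases hab with ha | hb
    · have : 0 < ‖a‖ := norm_pos_iff.2 ha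
      positivity
    · have : 0 < ‖b‖ := norm_pos_iff.2 hb
      positivity
  have hVpos : 0 < (L ^ 3) ^ M := by positivity
  have hp := momSq_nonneg L n
  have hX : 0 ≤ (M : ℝ) * (‖b‖ ^ 2 * momSq L n) := by positivity
  have hSV : 0 < (‖a‖ ^ 2 + M * ‖b‖ ^ 2) * (L ^ 3) ^ M := mul_pos hS hVpos
  rw [← ENNReal.ofReal_mul hX, ← ENNReal.ofReal_inv_of_pos hSV,
    ← ENNReal.ofReal_mul (inv_nonneg.2 hSV.le)]
  congr 1
  field_simp

/-! ### The constant and the tilted constant -/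

/-! Below, the "constant state" is the affine one-excitation state with `a = 1`, `b = 0`
(`affineState … (a := 1) (b := 0) …`, the normalised constant `L^{-3M/2}`) and the "tilted
constant" is the one with `a = 1`, `b = ε ∈ ℝ` (`(1 + ε N_{e₀} 1)/‖·‖`); both are written out in
full (no auxiliary definitions). -/

/-- The constant state has zero free energy. [folklore] -/
theorem periodicEnergy_zero_constState (hL : 0 < L) (hM : 0 < M) :
    periodicEnergy 0 (affineState (n := e0) (a := (1 : ℂ)) (b := (0 : ℂ)) hL hM e0_ne_zero (Or.inl one_ne_zero)) = 0 :=
  periodicEnergy_zero_affineState_const hL hM e0_ne_zero _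

/-- The tilted constant has free energy `Mε²|k|²/(1+Mε²) ≤ M ε² |k|²`. [folklore] -/
theorem periodicEnergy_zero_tiltState_le (hL : 0 < L) (hM : 0 < M) (ε : ℝ) :
    periodicEnergy 0 (affineState (n := e0) (a := (1 : ℂ)) (b := ((ε : ℝ) : ℂ)) hL hM e0_ne_zero (Or.inl one_ne_zero)) ≤ ENNReal.ofReal (M * ε ^ 2 * momSq L e0) := by
  rw [periodicEnergy_zero_affineState_eq hL hM e0_ne_zero]
  refine ENNReal.ofReal_le_ofReal ?_
  have hε : ‖(ε : ℂ)‖ ^ 2 = ε ^ 2 := by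
    rw [Complex.norm_real, Real.norm_eq_abs, sq_abs]
  rw [hε, norm_one, one_pow]
  have hp := momSq_nonneg L e0
  have hnum : 0 ≤ (M : ℝ) * ε ^ 2 * momSq L e0 := by positivity
  have hden : 1 ≤ 1 + (M : ℝ) * ε ^ 2 := by
    have : 0 ≤ (M : ℝ) * ε ^ 2 := by positivity
    linarith
  exact div_le_self hnum hden

/-- Pointwise form of the constant state: `L^{-3M/2}`. [folklore] -/
theorem constState_ψ (hL : 0 < L) (hM : 0 < M) (X : Config M) :
    (affineState (n := e0) (a := (1 : ℂ)) (b := (0 : ℂ)) hL hM e0_ne_zero (Or.inl one_ne_zero)).ψ X = ((Real.sqrt ((L ^ 3) ^ M) : ℝ) : ℂ)⁻¹ := by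
  unfold affineState
  rw [PeriodicTrialState.ofFun_apply, lintegral_cellN_nnnorm_sq_affine hL e0_ne_zero,
    ENNReal.toReal_ofReal (by positivity)]
  simp

/-- Pointwise form of the tilted constant. [folklore] -/
theorem tiltState_ψ (hL : 0 < L) (hM : 0 < M) (ε : ℝ) (X : Config M) :
    (affineState (n := e0) (a := (1 : ℂ)) (b := ((ε : ℝ) : ℂ)) hL hM e0_ne_zero (Or.inl one_ne_zero)).ψ X =
      ((Real.sqrt ((1 + M * ε ^ 2) * (L ^ 3) ^ M) : ℝ) : ℂ)⁻¹ *
        (1 + (ε : ℂ) * planeWaveSum L e0 X) := by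
  unfold affineState
  rw [PeriodicTrialState.ofFun_apply, lintegral_cellN_nnnorm_sq_affine hL e0_ne_zero,
    ENNReal.toReal_ofReal (by positivity)]
  have hε : ‖(ε : ℂ)‖ ^ 2 = ε ^ 2 := by
    rw [Complex.norm_real, Real.norm_eq_abs, sq_abs]
  rw [hε, norm_one, one_pow]

/-- **The inner product of the two states**: `⟨1/‖1‖, (1 + εN_k1)/‖·‖⟩ = (1 + Mε²)^{-1/2}`.
[folklore] -/
theorem integral_conj_constState_mul_tiltState (hL : 0 < L) (hM : 0 < M) (ε : ℝ) :
    ∫ X in cellN M L, conj ((affineState (n := e0) (a := (1 : ℂ)) (b := (0 : ℂ)) hL hM e0_ne_zero (Or.inl one_ne_zero)).ψ X) * (affineState (n := e0) (a := (1 : ℂ)) (b := ((ε : ℝ) : ℂ)) hL hM e0_ne_zero (Or.inl one_ne_zero)).ψ X =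
      ((Real.sqrt (1 + M * ε ^ 2) : ℝ) : ℂ)⁻¹ := by
  simp_rw [constState_ψ, tiltState_ψ]
  have hVpos : 0 < (L ^ 3) ^ M := by positivity
  have hTpos : 0 < 1 + (M : ℝ) * ε ^ 2 := by positivity
  have hS : Continuous (planeWaveSum (M := M) L e0) := (contDiff_planeWaveSum L e0).continuous
  have hconj : conj (((Real.sqrt ((L ^ 3) ^ M) : ℝ) : ℂ)⁻¹) =
      ((Real.sqrt ((L ^ 3) ^ M) : ℝ) : ℂ)⁻¹ := by
    rw [map_inv₀, Complex.conj_ofReal]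
  simp_rw [hconj]
  obtain ⟨A, hA⟩ : ∃ A : ℂ, ((Real.sqrt ((L ^ 3) ^ M) : ℝ) : ℂ)⁻¹ = A := ⟨_, rfl⟩
  obtain ⟨B, hB⟩ : ∃ B : ℂ, ((Real.sqrt ((1 + M * ε ^ 2) * (L ^ 3) ^ M) : ℝ) : ℂ)⁻¹ = B := ⟨_, rfl⟩
  simp_rw [hA, hB]
  have hexp : ∀ X : Config M,
      A * (B * (1 + (ε : ℂ) * planeWaveSum L e0 X)) = A * B + (A * B * ε) * planeWaveSum L e0 X := by
    intro X
    ring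
  simp_rw [hexp]
  have i1 : IntegrableOn (fun _ : Config M => A * B) (cellN M L) volume :=
    integrableOn_cellN continuous_const L
  have i2 : IntegrableOn (fun X : Config M => (A * B * ε) * planeWaveSum L e0 X) (cellN M L) volume :=
    integrableOn_cellN (continuous_const.mul hS) L
  rw [integral_add i1 i2, setIntegral_cellN_const hL.le, integral_const_mul,
    setIntegral_cellN_planeWaveSum hL e0_ne_zero, mul_zero, add_zero, ← hA, ← hB]
  have hreal : (L ^ 3) ^ M * ((Real.sqrt ((L ^ 3) ^ M))⁻¹ *
      (Real.sqrt ((1 + M * ε ^ 2) * (L ^ 3) ^ M))⁻¹) = (Real.sqrt (1 + M * ε ^ 2))⁻¹ := by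
    rw [Real.sqrt_mul hTpos.le]
    have hsV : 0 < Real.sqrt ((L ^ 3) ^ M) := Real.sqrt_pos.2 hVpos
    have hsT : 0 < Real.sqrt (1 + M * ε ^ 2) := Real.sqrt_pos.2 hTpos
    field_simp
    nlinarith [Real.mul_self_sqrt hVpos.le, Real.sq_sqrt hVpos.le]
  exact_mod_cast hreal

/-- Hence `|⟨Ψ, Ψ'⟩| = (1 + Mε²)^{-1/2}`. [folklore] -/
theorem norm_integral_conj_constState_mul_tiltState (hL : 0 < L) (hM : 0 < M) (ε : ℝ) :
    ‖∫ X in cellN M L, conj ((affineState (n := e0) (a := (1 : ℂ)) (b := (0 : ℂ)) hL hM e0_ne_zero (Or.inl one_ne_zero)).ψ X) * (affineState (n := e0) (a := (1 : ℂ)) (b := ((ε : ℝ) : ℂ)) hL hM e0_ne_zero (Or.inl one_ne_zero)).ψ X‖ =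
      (Real.sqrt (1 + M * ε ^ 2))⁻¹ := by
  rw [integral_conj_constState_mul_tiltState hL hM ε, norm_inv, Complex.norm_real,
    Real.norm_of_nonneg (Real.sqrt_nonneg _)]

/-- And `|⟨Ψ, Ψ'⟩| < 1` as soon as `ε ≠ 0` (and `M ≥ 1`): the two rays are distinct. [folklore] -/
theorem norm_integral_conj_constState_mul_tiltState_lt_one (hL : 0 < L) (hM : 0 < M) {ε : ℝ}
    (hε : ε ≠ 0) :
    ‖∫ X in cellN M L, conj ((affineState (n := e0) (a := (1 : ℂ)) (b := (0 : ℂ)) hL hM e0_ne_zero (Or.inl one_ne_zero)).ψ X) * (affineState (n := e0) (a := (1 : ℂ)) (b := ((ε : ℝ) : ℂ)) hL hM e0_ne_zero (Or.inl one_ne_zero)).ψ X‖ < 1 := by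
  rw [norm_integral_conj_constState_mul_tiltState hL hM ε]
  have hM' : (0 : ℝ) < M := by exact_mod_cast hM
  have hε2 : 0 < ε ^ 2 := by positivity
  have h1 : 1 < Real.sqrt (1 + M * ε ^ 2) := by
    rw [Real.lt_sqrt zero_le_one]
    nlinarith [mul_pos hM' hε2]
  exact inv_lt_one_of_one_lt₀ h1

/-! ### The tagged pair: near-minimisers at one coupling are not one ray -/

/-- **Two low-energy tagged states with distinct rays (free gas).** For `v = 0`, every `N`, every
`L > 0` and every window `δ > 0` there are tagged periodic trial states `Ψ, Ψ'` (one impurity + `N`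
bath bosons, equal masses) with tagged energies `⟨Ψ,H Ψ⟩ = 0` and `⟨Ψ',HΨ'⟩ ≤ δ` — so both are
`δ`-near-minimisers of the free tagged Hamiltonian, whose ground-state energy is `0` — and
`|⟨Ψ, Ψ'⟩| < 1`. Used against the zero speed majorant in `LocalSpeedBound` of line
`llp-fidelity-arc` (Disproof.lean §12). [folklore] -/
theorem exists_lowEnergy_tagged_pair_norm_inner_lt_one (N : ℕ) (hL : 0 < L) {δ : ℝ≥0∞}
    (hδ : 0 < δ) :
    ∃ Ψ Ψ' : TaggedPeriodicTrialState N L,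
      taggedPeriodicEnergy 0 1 Ψ = 0 ∧ taggedPeriodicEnergy 0 1 Ψ' ≤ δ ∧
      ‖∫ X in cellN (N + 1) L, conj (Ψ.ψ X) * Ψ'.ψ X‖ < 1 := by
  have hM : 0 < N + 1 := Nat.succ_pos N
  by_cases hδtop : δ = ⊤
  · refine ⟨(affineState (n := e0) (a := (1 : ℂ)) (b := (0 : ℂ)) hL hM e0_ne_zero (Or.inl one_ne_zero)).toTagged, (affineState (n := e0) (a := (1 : ℂ)) (b := ((1 : ℝ) : ℂ)) hL hM e0_ne_zero (Or.inl one_ne_zero)).toTagged, ?_, ?_, ?_⟩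
    · rw [taggedPeriodicEnergy_one_toTagged, periodicEnergy_zero_constState]
    · rw [hδtop]; exact le_top
    · simp only [PeriodicTrialState.toTagged_ψ]
      exact norm_integral_conj_constState_mul_tiltState_lt_one hL hM one_ne_zero
  · have hδpos : 0 < δ.toReal := ENNReal.toReal_pos hδ.ne' hδtop
    have hp : 0 < momSq L e0 := by
      rw [momSq_e0]
      positivity
    set D : ℝ := ((N + 1 : ℕ) : ℝ) * momSq L e0 + 1 with hD
    have hDpos : 0 < D := by positivity
    set ε : ℝ := Real.sqrt (δ.toReal / D) with hεdef
    have hε : 0 < ε := Real.sqrt_pos.2 (div_pos hδpos hDpos)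
    have hε2 : ε ^ 2 = δ.toReal / D := Real.sq_sqrt (div_pos hδpos hDpos).le
    refine ⟨(affineState (n := e0) (a := (1 : ℂ)) (b := (0 : ℂ)) hL hM e0_ne_zero (Or.inl one_ne_zero)).toTagged, (affineState (n := e0) (a := (1 : ℂ)) (b := ((ε : ℝ) : ℂ)) hL hM e0_ne_zero (Or.inl one_ne_zero)).toTagged, ?_, ?_, ?_⟩
    · rw [taggedPeriodicEnergy_one_toTagged, periodicEnergy_zero_constState]
    · rw [taggedPeriodicEnergy_one_toTagged]
      refine (periodicEnergy_zero_tiltState_le hL hM ε).trans ?_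
      have key : ((N + 1 : ℕ) : ℝ) * ε ^ 2 * momSq L e0 ≤ δ.toReal := by
        rw [hε2]
        have h1 : ((N + 1 : ℕ) : ℝ) * momSq L e0 ≤ D := by rw [hD]; linarith
        have h2 : 0 ≤ ((N + 1 : ℕ) : ℝ) * momSq L e0 := by positivity
        calc ((N + 1 : ℕ) : ℝ) * (δ.toReal / D) * momSq L e0
            = (((N + 1 : ℕ) : ℝ) * momSq L e0) / D * δ.toReal := by
              field_simp
          _ ≤ 1 * δ.toReal := by
              gcongr
              rw [div_le_one hDpos]
              exact h1
          _ = δ.toReal := one_mul _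
      calc ENNReal.ofReal (((N + 1 : ℕ) : ℝ) * ε ^ 2 * momSq L e0)
          ≤ ENNReal.ofReal δ.toReal := ENNReal.ofReal_le_ofReal key
        _ = δ := ENNReal.ofReal_toReal hδtop
    · simp only [PeriodicTrialState.toTagged_ψ]
      exact norm_integral_conj_constState_mul_tiltState_lt_one hL hM hε.ne'

/-! ### Tightness of spectral-gap rigidity -/

/-- **The witness pair saturates spectral-gap rigidity (tightness).** For the free `M`-body torus
problem the gap above the constant ground state is `|k|² = (2π/L)²` and Parseval gives
`⟨Ψ,-ΔΨ⟩ ≥ |k|² (1 − |⟨Ψ₀, Ψ⟩|²)`; the tilted constant attains EQUALITY: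
`⟨Ψ_ε,-ΔΨ_ε⟩ = |k|² (1 − |⟨Ψ₀,Ψ_ε⟩|²)` (`= M ε²|k|²/(1+Mε²)`). So the rigidity constant a prover of
`LocalSpeedBound` needs ("`δ`-near-minimiser ⇒ within angle `arcsin √(δ/gap)` of the ground ray")
cannot be improved: at a node `λ` with budget `b = ∫_{[λ,λ']} s` the admissible window is
`δ ≲ gap_N · sin² b`, and `gap_N → 0` along `N` (free `4π²/L² ∼ N^{-2/3}`, interacting phonon
`c_s·2π/L ∼ N^{-1/3}`) — consistent with `δ` being chosen after `N` and `λ'` in the line, and with §7.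
[folklore] -/
theorem tilt_saturates_gap_rigidity (hL : 0 < L) (hM : 0 < M) (ε : ℝ) :
    periodicEnergy 0
        (affineState (n := e0) (a := (1 : ℂ)) (b := ((ε : ℝ) : ℂ)) hL hM e0_ne_zero (Or.inl one_ne_zero)) =
      ENNReal.ofReal (momSq L e0 * (1 -
        ‖∫ X in cellN M L,
            conj ((affineState (n := e0) (a := (1 : ℂ)) (b := (0 : ℂ)) hL hM e0_ne_zero
              (Or.inl one_ne_zero)).ψ X) *
              (affineState (n := e0) (a := (1 : ℂ)) (b := ((ε : ℝ) : ℂ)) hL hM e0_ne_zero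
                (Or.inl one_ne_zero)).ψ X‖ ^ 2)) := by
  rw [periodicEnergy_zero_affineState_eq hL hM e0_ne_zero,
    norm_integral_conj_constState_mul_tiltState hL hM ε]
  congr 1
  have hε : ‖(ε : ℂ)‖ ^ 2 = ε ^ 2 := by rw [Complex.norm_real, Real.norm_eq_abs, sq_abs]
  have hT : 0 < 1 + (M : ℝ) * ε ^ 2 := by positivity
  rw [hε, norm_one, one_pow, inv_pow, Real.sq_sqrt hT.le]
  field_simp
  ring

end Summit.AtomisticToContinuum.BoseEinsteinCondensation.Theorems.CorrectorClosure.Negative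

end
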